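import Summits.BirchSwinnertonDyer.BirchSwinnertonDyer.Theorems.ByReductionTypeAtTwoSupersingularFlatBlindLocalCount
import Summits.BirchSwinnertonDyer.BirchSwinnertonDyer.Theorems.ByReductionTypeAtTwoSupersingularFlatBlindTwistedLift
import Summits.BirchSwinnertonDyer.BirchSwinnertonDyer.Theorems.ByReductionTypeAtTwoSupersingularFlatBlindTwistSide
import Summits.BirchSwinnertonDyer.BirchSwinnertonDyer.Theorems.ByReductionTypeAtTwoSupersingularFlatBlindHondaRung
import Literature.NumberTheory.EllipticCurves.ModularityVersionApProofs
import Literature.NumberTheory.EllipticCurves.QuadraticTwist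
import HarnessLib

/-!
# Route `ByReductionTypeAtTwo` (rung K4), crux `SupersingularRankZeroAtTwo` (item stmt-BirchSwinnertonDyer-19097), line
# `odd_blind_package` (registered v2.6.1, tree v2.8) slot 5: **THE GLUE FOR CDF_glob** — `OddBlindPackage.FlatBlindControlOfLocalAtTwo`
# (the ψ₂-twisted control theorem: `Sel♭(E/ℚ_∞)[γ+1]` is FINITE given the pointwise local transversality) FOLLOWS FROM ONE TWIST-SIDE
# STATEMENT, HT-2 (`h1` of `HOME/ss/gen19/HAND-TARGETS-CDFglob.md`, hand tower-1 — a tree theorem since p811978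
# `FlatBlindTwistSide.HT2_exists_bound_strict_mul_relindex`), by three tree theorems: HT-1 (LEAD, p812030
# `OddBlindLocal.finite_and_natCard_flat_inf_kummerLine_le`), the count skeleton (t42, p807657
# `OddBlindTwist.natCard_selmerGroup_update_le_uniform`) and HT-3 (t42, p811173 `OddBlindTwist.HT3_finite_endInvariants_of_uniform_bound`);
# hence ★★★ `flatBlindControlOfLocalAtTwo` — **CDF_glob IS AN UNCONDITIONAL THEOREM**, type = the body of the line's def VERBATIM
# (cell `bsd-2adic`, seat `ss-1` GEN 20, (L3) of pen SUMMON 20260831T051227Z).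

HONEST FRAMING: THEOREMS ONLY (no definition, no named fact, no instance, no `sorry`); `--supports 19097`.  What is closed is slot 5's
conjunct CDF_glob (`OddBlindPackage.FlatBlindControlOfLocalAtTwo`, v2.6–v2.8 :862) as a NAMED theorem with the def's body as its type; the
registered stub `stub_CD` (v2.6.1: CDF± ∧ CDF_glob ∧ CDC; v2.8: CDF_glob ∧ CDC) is NOT discharged by this file (CDC — the Poitou–Tate /
Cassels CARDINALITY — remains); nothing here proves CDF± as typed, CDC, stubs 1–4/6/7 or the crux; BSD is proved for no curve by any of this.

## What is proved
* `exists_finset_hasGoodReductionAt_outside` — bookkeeping: for `W/ℚ` and a place `v ∋ 2` there is a finite `S₀ ∌ v` off which (and off `2`)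
  `W` has good reduction (the bad places other than `v`; `p ∣ N_W ↔` bad, `dvd_conductorNorm_iff`).
* ★ `flatBlindControlOfLocalAtTwo_of_HT2` — `(∀ W … P hP, HT-2) → <body of OddBlindPackage.FlatBlindControlOfLocalAtTwo, verbatim>`:
  given the line's binders and the pointwise `hloc`, take `S₀` as above; HT-2 bounds `#H¹_{𝓕^0_J,S₀} · [H¹_{𝓖'_J,S₀} : H¹_{𝓕^{K_J},S₀}] ≤ C₁`;
  HT-1 bounds `#(L♭_J ⊓ K_J) ≤ 4`; the count skeleton gives `#H¹_{𝓕♭_J,S₀} ≤ 4 C₁` for all `J` (the ♭ structure IS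
  `𝓕^{ker[v ↦ L♭_J]}` by `rfl`); HT-3 lifts the uniform bound to `Finite (Sel♭_∞[γ+1])`.
* ★★★ `flatBlindControlOfLocalAtTwo` — the same statement UNCONDITIONALLY, feeding `hHT2` by tower-1's
  `FlatBlindTwistSide.HT2_exists_bound_strict_mul_relindex` (p811978).

References: [GreenbergLNM1716] R. Greenberg, LNM 1716 (1999), §4 pp. 122–124 (twisted descent, strict/relaxed conditions at `p`);
[Sprung2012] F. Sprung, J. Number Theory 132 (2012), Def. 7.9 / 7.11 (p. 1503);
[SilvermanAEC2009] VIII (N_E and bad primes), VII Prop. 6.3.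
-/

set_option autoImplicit false
set_option linter.dupNamespace false

noncomputable section

open scoped Classical NumberField

namespace Summit.BirchSwinnertonDyer.BirchSwinnertonDyer.Theorems

namespace OddBlindLocal

open NumberField IsDedekindDomain Field WeierstrassCurve Literature.NumberTheory.EllipticCurves
  Literature.NumberTheory.EllipticCurves.IwasawaDual Literature.NumberTheory.GaloisRepresentations
  Literature.NumberTheory.GaloisCohomology ZpExtension Literature.NumberTheory.EllipticCurves.Kobayashi2003
  Literature.NumberTheory.EllipticCurves.Sprung2017 Literature.NumberTheory.EllipticCurves.Sprung2012
  Literature.NumberTheory.EllipticCurves.Rank1Residual Rat.HeightOneSpectrum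
open Literature.NumberTheory.GaloisRepresentations.DiscreteGaloisModule (unramifiedSubgroup SelmerStructure)

/-! ## §1 A finite set of places off which `W` has good reduction, avoiding the place over `2` -/

/-- **Bookkeeping: the bad places of `W/ℚ` other than `v`.**  For `W/ℚ` elliptic and a place `v` with `2 ∈ v`, there is a finite set `S₀`
of finite places with `v ∉ S₀` such that `W` has good reduction at every `v' ∉ S₀` with `2 ∉ v'` (take the places of bad reduction — finitely
many, as their primes divide the conductor — and remove `v`). [cite: SilvermanAEC2009, VIII §1 and VII Prop. 5.1 (N_E is divisible exactly by the bad primes)] -/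
theorem exists_finset_hasGoodReductionAt_outside (W : WeierstrassCurve ℚ) [W.IsElliptic] (v : HeightOneSpectrum (𝓞 ℚ))
    (hv : (2 : 𝓞 ℚ) ∈ v.asIdeal) :
    ∃ S₀ : Finset (HeightOneSpectrum (𝓞 ℚ)), v ∉ S₀ ∧
      ∀ v' : HeightOneSpectrum (𝓞 ℚ), v' ∉ S₀ → (2 : 𝓞 ℚ) ∉ v'.asIdeal → W.HasGoodReductionAt v' := by
  have hN0 : W.conductorNorm ℤ ≠ 0 := (W.conductorNorm_pos_holds).ne'
  have hfin : {v' : HeightOneSpectrum (𝓞 ℚ) | ¬ W.HasGoodReductionAt v'}.Finite := by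
    refine Set.Finite.subset (((W.conductorNorm ℤ).primeFactors.finite_toSet).preimage
      (f := fun v' : HeightOneSpectrum (𝓞 ℚ) ↦ ((primesEquiv v' : Nat.Primes) : ℕ)) fun a _ b _ hab ↦ ?_) ?_
    · exact primesEquiv.injective (Subtype.ext hab)
    · intro v' hv'
      rw [Set.mem_preimage, Finset.mem_coe, Nat.mem_primeFactors]
      exact ⟨(primesEquiv v').2, (W.dvd_conductorNorm_iff v').mpr hv', hN0⟩
  refine ⟨hfin.toFinset.erase v, fun h ↦ (Finset.mem_erase.mp h).1 rfl, fun v' hv'S h2 ↦ ?_⟩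
  by_contra hbad
  refine hv'S (Finset.mem_erase.mpr ⟨?_, hfin.mem_toFinset.mpr hbad⟩)
  rintro rfl
  exact h2 hv

/-! ## §2 CDF_glob from HT-2 -/

/-- ★ **THE GLUE: CDF_glob ⟸ HT-2.**  The hypothesis `hHT2` is the universal closure of the hand target HT-2 VERBATIM (LEAD ss-1 GEN 19,
`HOME/ss/gen19/HAND-TARGETS-CDFglob.md` §2 h1; hand tower-1): for the rank-1 twist data `(W₂, htw, hr, hsha, ι, P, hP)` of the line, a finite
`S₀ ∌ v` with good reduction off `S₀ ∪ {2}`, the cyclotomic `κ` and a local lift `g` of a topological generator, the level-`J` twisted Selmer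
groups STRICT at `v` and the index «relaxed at `v` : Kummer line of the twist at `v`» are bounded uniformly in `J`.  The conclusion is VERBATIM
the body of `OddBlindPackage.FlatBlindControlOfLocalAtTwo` (line `odd_blind_package` v2.6–v2.8, slot 5's conjunct CDF_glob): the line's
binders, the pointwise local transversality `hloc`, the twist tail, then `Finite (Sel♭(E/ℚ_∞)[γ+1])`.  Proof = composition of tree theorems:
`S₀` from §1; `C₁` from `hHT2`; HT-1 (`finite_and_natCard_flat_inf_kummerLine_le`, p812030: `#(L♭_J ⊓ K_J) ≤ 4`); the count skeleton
`OddBlindTwist.natCard_selmerGroup_update_le_uniform` (p807657: `#H¹_{𝓕♭_J,S₀} ≤ C₁·4`, the ♭ structure being `𝓕^{ker[v ↦ L♭_J]}`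
definitionally); HT-3 `OddBlindTwist.HT3_finite_endInvariants_of_uniform_bound` (p811173).  The unused line binders (`hCM`, `hodd`, `hcv`,
`hc`, `htr`, `hz`, `hsat`) are carried because the target text carries them.  CONDITIONAL on `hHT2`; nothing about the crux is asserted;
BSD is proved for no curve. [cite: GreenbergLNM1716, §4 pp. 122–124] [cite: Sprung2012, Def. 7.9 and Def. 7.11 (p. 1503)] -/
theorem flatBlindControlOfLocalAtTwo_of_HT2
    (hHT2 : ∀ (W : WeierstrassCurve ℚ) [W.IsElliptic] [W.IsGloballyMinimal], GoodSS W 2 →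
      ∀ {κ : ZpExtension ℚ 2}, κ.IsCyclotomic → ∀ (v : HeightOneSpectrum (𝓞 ℚ)), (2 : 𝓞 ℚ) ∈ v.asIdeal →
      ∀ {g : absoluteGaloisGroup (v.adicCompletion ℚ)},
        κ.IsTopGenerator (resGalOfEmb (closureEmb (K := ℚ) (v.adicCompletion ℚ)) g) →
      ∀ (S₀ : Finset (HeightOneSpectrum (𝓞 ℚ))), v ∉ S₀ →
        (∀ v' : HeightOneSpectrum (𝓞 ℚ), v' ∉ S₀ → (2 : 𝓞 ℚ) ∉ v'.asIdeal → W.HasGoodReductionAt v') →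
      ∀ (W₂ : WeierstrassCurve ℚ) [W₂.IsElliptic] [W₂.IsGloballyMinimal],
        (∃ C : WeierstrassCurve.VariableChange ℚ, C • W.quadraticTwist 2 = W₂) →
        W₂.mordellWeilRank = 1 → Finite (AddCommGroup.primaryComponent W₂.sha 2) →
      ∀ (ι : ℚ →+* ℚ_[2]) (P : (W₂.baseChange ℚ).toAffine.Point), ¬ IsOfFinAddOrder P →
      ∃ C : ℕ, ∀ J : ℕ,
        Nat.card (W.twistedSelmerStructureOfLocal 2 S₀ κ J (-1) OddBlindTwist.two_dvd_neg_one_sub_one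
            (Function.update (fun v' ↦ (W.twistedTorsionToLocalH1 2 κ J (-1) OddBlindTwist.two_dvd_neg_one_sub_one
              (v'.adicCompletion ℚ)).ker) v ⊥)).selmerGroup *
          Nat.card ((W.twistedSelmerStructureOfLocal 2 S₀ κ J (-1) OddBlindTwist.two_dvd_neg_one_sub_one
              (Function.update (fun v' ↦ (W.twistedTorsionToLocalH1 2 κ J (-1) OddBlindTwist.two_dvd_neg_one_sub_one
                (v'.adicCompletion ℚ)).ker) v ⊤)).selmerGroup ⧸
            ((W.twistedSelmerStructureOfLocal 2 S₀ κ J (-1) OddBlindTwist.two_dvd_neg_one_sub_one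
              (Function.update (fun v' ↦ (W.twistedTorsionToLocalH1 2 κ J (-1) OddBlindTwist.two_dvd_neg_one_sub_one
                (v'.adicCompletion ℚ)).ker) v
                (W.twistedTorsionLocalKummer 2 κ J (-1) OddBlindTwist.two_dvd_neg_one_sub_one (v.adicCompletion ℚ)
                  (localLayerPointsOfEmb κ (closureEmb (K := ℚ) (v.adicCompletion ℚ)) W 1 ⊓
                    (DistribSMul.toAddMonoidHom (localPoints W (v.adicCompletion ℚ)) g +
                      AddMonoidHom.id _).ker)))).selmerGroup).addSubgroupOf
            (W.twistedSelmerStructureOfLocal 2 S₀ κ J (-1) OddBlindTwist.two_dvd_neg_one_sub_one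
              (Function.update (fun v' ↦ (W.twistedTorsionToLocalH1 2 κ J (-1) OddBlindTwist.two_dvd_neg_one_sub_one
                (v'.adicCompletion ℚ)).ker) v ⊤)).selmerGroup) ≤ C) :
    ∀ (W : WeierstrassCurve ℚ) [W.IsElliptic] [W.IsGloballyMinimal],
    ¬ W.HasCM → GoodSS W 2 → W.rootNumber * ZMod.χ₈ (W.conductorNorm ℤ : ZMod 8) = -1 →
    ∀ (κ : ZpExtension ℚ 2) (γ : Field.absoluteGaloisGroup ℚ),
      κ.IsCyclotomic → κ.IsTopGenerator γ → IsCyclotomicVariable 2 γ →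
    ∀ (v : HeightOneSpectrum (𝓞 ℚ)), (2 : 𝓞 ℚ) ∈ v.asIdeal →
    ∀ (g : Field.absoluteGaloisGroup (v.adicCompletion ℚ)) (c : ℕ → localPoints W (v.adicCompletion ℚ)),
      κ.IsTopGenerator (resGalOfEmb (closureEmb (K := ℚ) (v.adicCompletion ℚ)) g) →
      (∀ n, c n ∈ localLayerPointsOfEmb κ (closureEmb (K := ℚ) (v.adicCompletion ℚ)) W n) →
      (∀ n, 1 ≤ n → localTraceOfEmb κ (closureEmb (K := ℚ) (v.adicCompletion ℚ)) W n (n + 1)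
        (c (n + 1)) = W.frobeniusTrace 2 • c n - c (n - 1)) →
      (∀ z₀ : localLayerPointsOfEmb κ (closureEmb (K := ℚ) (v.adicCompletion ℚ)) W 0 →+ ℤ_[2],
        evalOn W (localLayerPointsOfEmb κ (closureEmb (K := ℚ) (v.adicCompletion ℚ)) W 0) z₀ (c 0) = 0 →
          z₀ = 0) →
      (∀ a : ℤ_[2],
        (∃ z₀ : localLayerPointsOfEmb κ (closureEmb (K := ℚ) (v.adicCompletion ℚ)) W 0 →+ ℤ_[2],
          evalOn W (localLayerPointsOfEmb κ (closureEmb (K := ℚ) (v.adicCompletion ℚ)) W 0) z₀ (c 0) = 2 * a) →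
        ∃ y : localLayerPointsOfEmb κ (closureEmb (K := ℚ) (v.adicCompletion ℚ)) W 0 →+ ℤ_[2],
          evalOn W (localLayerPointsOfEmb κ (closureEmb (K := ℚ) (v.adicCompletion ℚ)) W 0) y (c 0) = a) →
      (∀ (y : localPoints W (v.adicCompletion ℚ))
        (hy : y ∈ localLayerPointsOfEmb κ (closureEmb (K := ℚ) (v.adicCompletion ℚ)) W 1), g • y = -y →
        ∀ k : ℕ, (∀ w ∈ localLayerPointsOfEmb κ (closureEmb (K := ℚ) (v.adicCompletion ℚ)) W 1, 2 ^ k • w ≠ y) →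
          ∃ z ∈ colemanKer κ (closureEmb (K := ℚ) (v.adicCompletion ℚ)) W (W.frobeniusTrace 2) g c .flat,
            ¬ (2 : ℤ_[2]) ^ (k + 1) ∣
              z ⟨y, localLayerPointsOfEmb_le_localTowerPointsOfEmb κ (closureEmb (K := ℚ) (v.adicCompletion ℚ)) W 1 hy⟩) →
    ∀ (W₂ : WeierstrassCurve ℚ) [W₂.IsElliptic] [W₂.IsGloballyMinimal],
      (∃ C : WeierstrassCurve.VariableChange ℚ, C • W.quadraticTwist 2 = W₂) →
      W₂.mordellWeilRank = 1 → Finite (AddCommGroup.primaryComponent W₂.sha 2) →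
    ∀ (ι : ℚ →+* ℚ_[2]) (P : (W₂.baseChange ℚ).toAffine.Point), ¬ IsOfFinAddOrder P →
      Finite (endInvariants (conjSharpFlatSelmerInfty W κ (closureEmb (K := ℚ) (v.adicCompletion ℚ))
        (W.frobeniusTrace 2) g c .flat γ + 1)) := by
  intro W _ _ _hCM hss _hodd κ γ hκ hγ _hcv v hv g c hg _hc _htr _hz _hsat hloc W₂ _ _ htw hr hsha ι P hP
  -- the finite set of bad places off `v`
  obtain ⟨S₀, hvS, hbad⟩ := exists_finset_hasGoodReductionAt_outside W v hv
  have hv' : ((2 : ℕ) : 𝓞 ℚ) ∈ v.asIdeal := by exact_mod_cast hv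
  have hbad' : ∀ v' : HeightOneSpectrum (𝓞 ℚ), v' ∉ S₀ → ((2 : ℕ) : 𝓞 ℚ) ∉ v'.asIdeal → W.HasGoodReductionAt v' :=
    fun v' h1 h2 ↦ hbad v' h1 (by exact_mod_cast h2)
  -- HT-2: the twist side
  obtain ⟨C₁, hC₁⟩ := hHT2 W hss hκ v hv hg S₀ hvS hbad W₂ htw hr hsha ι P hP
  -- HT-1: the local count, for the ♭ kernel of the system `c`
  have hHT1 := fun J ↦ finite_and_natCard_flat_inf_kummerLine_le W hss κ J OddBlindTwist.two_dvd_neg_one_sub_one v hv hg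
    (colemanKer κ (closureEmb (K := ℚ) (v.adicCompletion ℚ)) W (W.frobeniusTrace 2) g c .flat) hloc
  -- the count skeleton: a uniform bound on the ♭-twisted Selmer groups (`convert`: the generic-`K` lemma instantiated at `ℚ`)
  have hunif := OddBlindTwist.natCard_selmerGroup_update_le_uniform W 2 S₀ κ (-1) OddBlindTwist.two_dvd_neg_one_sub_one
    (fun J v' ↦ (W.twistedTorsionToLocalH1 2 κ J (-1) OddBlindTwist.two_dvd_neg_one_sub_one (v'.adicCompletion ℚ)).ker)
    v hvS hv' hbad'
    (fun J ↦ W.twistedSharpFlatLocalKummer 2 κ J (-1) OddBlindTwist.two_dvd_neg_one_sub_one (v.adicCompletion ℚ)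
      (localTowerPointsOfEmb κ (closureEmb (K := ℚ) (v.adicCompletion ℚ)) W)
      (colemanKer κ (closureEmb (K := ℚ) (v.adicCompletion ℚ)) W (W.frobeniusTrace 2) g c .flat))
    (fun J ↦ W.twistedTorsionLocalKummer 2 κ J (-1) OddBlindTwist.two_dvd_neg_one_sub_one (v.adicCompletion ℚ)
      (localLayerPointsOfEmb κ (closureEmb (K := ℚ) (v.adicCompletion ℚ)) W 1 ⊓
        (DistribSMul.toAddMonoidHom (localPoints W (v.adicCompletion ℚ)) g + AddMonoidHom.id _).ker))
    (C₁ := C₁) (C₂ := 4) (fun J ↦ by convert hC₁ J using 4) (fun J ↦ by convert hHT1 J using 4)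
  -- HT-3: the lift (the ♭ structure is `𝓕^{ker[v ↦ L♭_J]}` by definition)
  refine OddBlindTwist.HT3_finite_endInvariants_of_uniform_bound W hss hκ hγ v hv g c S₀ hvS hbad ⟨C₁ * 4, fun J ↦ ?_⟩
  rw [WeierstrassCurve.twistedSharpFlatSelmerStructure, WeierstrassCurve.twistedSharpFlatLocalFamily]
  convert hunif J using 4

/-- ★★★ **CDF_glob IS A THEOREM: `Sel♭(E/ℚ_∞)[γ+1]` is FINITE given the pointwise local transversality** — the statement of slot 5's
conjunct `OddBlindPackage.FlatBlindControlOfLocalAtTwo` of the line `odd_blind_package` (crux `SupersingularRankZeroAtTwo`), its body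
VERBATIM as the type: for `W/ℚ` globally minimal, non-CM, good supersingular at `2`, odd sign `w(E)·χ₈(N) = −1`, the cyclotomic `κ` with `γ`,
`v ∋ 2`, a local lift `g` and an (L)(TR)(Z)(SAT)-system `c`, IF every `ψ₂`-vector of layer `1` outside `2^k E(ℚ_{1,v})` is detected modulo
`2^{k+1}` by `Ker Col♭_c` (CDF±'s conclusion for these binders), THEN for every globally minimal model `W₂` of the quadratic twist by `2` of
rank `1` with finite `Ш[2^∞]`, every `ι`, and every point `P` of infinite order, `endInvariants (conjSharpFlatSelmerInfty … .flat γ + 1)` is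
finite.  Proof: `flatBlindControlOfLocalAtTwo_of_HT2` with HT-2 = `FlatBlindTwistSide.HT2_exists_bound_strict_mul_relindex` (tower-1 GEN 58,
p811978).  Every input is a tree theorem (HT-1 p812030, count p807657, HT-3 p811173, HT-2 p811978; VII.6.3 and Poitou–Tate DISCHARGED
Literature facts); axioms standard.  HONEST: closes the conjunct CDF_glob of `stub_CD` only — CDC (the cardinality identity) and the other
six stubs stay open; BSD is proved for no curve. [cite: GreenbergLNM1716, §4 pp. 122–124] [cite: Sprung2012, Def. 7.9 and Def. 7.11 (p. 1503)] -/
theorem flatBlindControlOfLocalAtTwo :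
    ∀ (W : WeierstrassCurve ℚ) [W.IsElliptic] [W.IsGloballyMinimal],
    ¬ W.HasCM → GoodSS W 2 → W.rootNumber * ZMod.χ₈ (W.conductorNorm ℤ : ZMod 8) = -1 →
    ∀ (κ : ZpExtension ℚ 2) (γ : Field.absoluteGaloisGroup ℚ),
      κ.IsCyclotomic → κ.IsTopGenerator γ → IsCyclotomicVariable 2 γ →
    ∀ (v : HeightOneSpectrum (𝓞 ℚ)), (2 : 𝓞 ℚ) ∈ v.asIdeal →
    ∀ (g : Field.absoluteGaloisGroup (v.adicCompletion ℚ)) (c : ℕ → localPoints W (v.adicCompletion ℚ)),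
      κ.IsTopGenerator (resGalOfEmb (closureEmb (K := ℚ) (v.adicCompletion ℚ)) g) →
      (∀ n, c n ∈ localLayerPointsOfEmb κ (closureEmb (K := ℚ) (v.adicCompletion ℚ)) W n) →
      (∀ n, 1 ≤ n → localTraceOfEmb κ (closureEmb (K := ℚ) (v.adicCompletion ℚ)) W n (n + 1)
        (c (n + 1)) = W.frobeniusTrace 2 • c n - c (n - 1)) →
      (∀ z₀ : localLayerPointsOfEmb κ (closureEmb (K := ℚ) (v.adicCompletion ℚ)) W 0 →+ ℤ_[2],
        evalOn W (localLayerPointsOfEmb κ (closureEmb (K := ℚ) (v.adicCompletion ℚ)) W 0) z₀ (c 0) = 0 →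
          z₀ = 0) →
      (∀ a : ℤ_[2],
        (∃ z₀ : localLayerPointsOfEmb κ (closureEmb (K := ℚ) (v.adicCompletion ℚ)) W 0 →+ ℤ_[2],
          evalOn W (localLayerPointsOfEmb κ (closureEmb (K := ℚ) (v.adicCompletion ℚ)) W 0) z₀ (c 0) = 2 * a) →
        ∃ y : localLayerPointsOfEmb κ (closureEmb (K := ℚ) (v.adicCompletion ℚ)) W 0 →+ ℤ_[2],
          evalOn W (localLayerPointsOfEmb κ (closureEmb (K := ℚ) (v.adicCompletion ℚ)) W 0) y (c 0) = a) →
      (∀ (y : localPoints W (v.adicCompletion ℚ))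
        (hy : y ∈ localLayerPointsOfEmb κ (closureEmb (K := ℚ) (v.adicCompletion ℚ)) W 1), g • y = -y →
        ∀ k : ℕ, (∀ w ∈ localLayerPointsOfEmb κ (closureEmb (K := ℚ) (v.adicCompletion ℚ)) W 1, 2 ^ k • w ≠ y) →
          ∃ z ∈ colemanKer κ (closureEmb (K := ℚ) (v.adicCompletion ℚ)) W (W.frobeniusTrace 2) g c .flat,
            ¬ (2 : ℤ_[2]) ^ (k + 1) ∣
              z ⟨y, localLayerPointsOfEmb_le_localTowerPointsOfEmb κ (closureEmb (K := ℚ) (v.adicCompletion ℚ)) W 1 hy⟩) →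
    ∀ (W₂ : WeierstrassCurve ℚ) [W₂.IsElliptic] [W₂.IsGloballyMinimal],
      (∃ C : WeierstrassCurve.VariableChange ℚ, C • W.quadraticTwist 2 = W₂) →
      W₂.mordellWeilRank = 1 → Finite (AddCommGroup.primaryComponent W₂.sha 2) →
    ∀ (ι : ℚ →+* ℚ_[2]) (P : (W₂.baseChange ℚ).toAffine.Point), ¬ IsOfFinAddOrder P →
      Finite (endInvariants (conjSharpFlatSelmerInfty W κ (closureEmb (K := ℚ) (v.adicCompletion ℚ))
        (W.frobeniusTrace 2) g c .flat γ + 1)) :=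
  flatBlindControlOfLocalAtTwo_of_HT2 fun W _ _ hss _ hκ v hv _ hg S₀ hvS hbad W₂ _ _ htw hr hsha ι P hP ↦
    FlatBlindTwistSide.HT2_exists_bound_strict_mul_relindex W hss hκ v hv hg S₀ hvS hbad W₂ htw hr hsha ι P hP

end OddBlindLocal

end Summit.BirchSwinnertonDyer.BirchSwinnertonDyer.Theorems

end
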